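import Summits.NavierStokesRegularity.FluidComputer.GeometricFace
import Summits.NavierStokesRegularity.NavierStokesRegularity.Theorems.FluidComputerCascade
import Literature.Analysis.FluidPDE.TypeIStretchingThreshold
import HarnessLib

/-!
# Fluid computer — L66 / E2″: THE VORTEX-STRETCHING TYPE-I THRESHOLD, CONSTANT ONE:
# `limsup_{t↑T} (T − t)·sup_x α⁺(t, x) ≥ 1`, `α = ⟪ξ, ∇u ξ⟫ = ⟪ξ, Sξ⟩`, `ξ = ω/|ω|` — viscous AND Euler

HONEST FRAMING (cell `pub-fluidc`, verbatim): *low prior, high value-of-information experiment on Tao's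
machine paradigm; NOT a claim that NS blows up.* Theorem side of the cell (the level dictionary); nothing here is
evidence of blow-up — necessities for EVERY maximal smooth finite-energy solution on `ℝ³` (and, for E2″, for every
maximal classical Euler solution of the Beale–Kato–Majda class).

L63 / E2 (Chae's threshold) bound `(T − t)·‖∇u(t)‖_∞` from below by `1 − o(1)` along a sequence of times. The
maximum-principle proof behind them uses the gradient only through the STRETCHING term `⟪ω, ∇u ω⟫ ≤ ‖∇u‖|ω|²`; the
Literature kernel `TypeIStretchingThreshold` (this lane, `ν ≥ 0`) keeps exactly that:
`(T − t)⟪ω, ∇u ω⟫ ≤ M₀|ω|²` on a terminal window with `M₀ < 1` forces continuation. Read on the classes of the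
dictionary:

* `ns_stretching_typeI_threshold` (**L66 — THE STRETCHING THRESHOLD FOR NAVIER–STOKES, CONSTANT ONE**): along every
  maximal smooth solution `(u, p)` of the unforced Navier–Stokes system on `ℝ³ × [0, T)` (`ν > 0`), Leray–Hopf from
  `u 0`, for every `M₀ < 1` and every `t₀ ∈ [0, T)` there are `t ∈ [t₀, T)` and `x` with
  `M₀ |ω(t, x)|² < (T − t)·⟪ω(t, x), ∇u(t, x) ω(t, x)⟫` — i.e. `ω(t, x) ≠ 0` and the vortex-stretching rate
  `α(t, x) = ⟪ξ, Sξ⟩` exceeds `M₀/(T − t)`: `limsup_{t↑T} (T − t)·sup_{ω ≠ 0} α ≥ 1` (interior translate, class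
  discharged by `GeometricFace.hasBoundedSobolevNormsOn_translate`);
* `ns_stretching_typeI_frequently` — filter form; `ns_stretching_typeI_threshold_of_cascadeWitness` — interface reading;
* `euler_stretching_typeI_threshold` (**E2″**): the same for maximal classical Euler solutions in the Beale–Kato–Majda class
  on closed sub-slabs (class carried, as E1–E2).

Placement: `α ≤ λ_max(S) ≤ ‖S‖ ≤ ‖∇u‖` pointwise — L66 IMPLIES L63 (and E2″ implies E2) and bounds the LARGEST STRAIN
EIGENVALUE ALONG THE VORTICITY DIRECTION with the explicit constant `1` (L64 bounds the middle eigenvalue `λ₂` by `1/4`,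
L65 the vorticity modulus by `1/4`; pointwise `α`, `λ₂`, `|ω|` are independent). Reading for the machine paradigm: at
the points and times that matter, vortex lines must be STRETCHED at the self-similar rate — `(T − t)·α → ≥ 1` along a
sequence; a design whose stretching rate in the intense region stays below `(1 − η)/(T − t)` is not approaching a
singularity at that `T`, viscous or inviscid. HONEST: Chae 2010 Thm 1.1 is printed with `‖∇v‖_∞` (Euler); the `α`-form
is the same proof with Constantin's `|ω|`-inequality — not located in print with the constant `1`; weak form only.
Necessity only. 0 sorry; no definitions; no named facts.

## References

* D. Chae, J. Funct. Anal. 258 (2010) 2865–2883 = arXiv:0711.1113, Thm. 1.1 (proof p. 3–4). [Chae2010]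
* P. Constantin, SIAM Rev. 36 (1994) 73–98, §2 (`α = ⟪ξ, Sξ⟩`). [Constantin1994]
* J. T. Beale, T. Kato, A. Majda, Comm. Math. Phys. 94 (1984) 61–66, Thm. 1. [BealeKatoMajda1984]
* T. Tao, Anal. PDE 6 (2013) = arXiv:1108.1165, Cor. 11.1 (the class hypothesis for Navier–Stokes). [Tao2011]
-/

noncomputable section

open MeasureTheory Set Function Filter Topology Metric
open scoped ENNReal NNReal RealInnerProductSpace
open Literature.Analysis.FluidPDE Literature.Analysis.FunctionSpaces
open Literature.Analysis.FluidPDE.FluidComputer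
open Summit.NavierStokesRegularity.NavierStokesRegularity.Theorems.FluidComputer (x5a_of_cascadeWitness')

namespace Summit.NavierStokesRegularity.FluidComputer.StretchingTypeIFace

/-! ## L66: the stretching threshold for Navier–Stokes blow-up -/

/-- **L66 — THE VORTEX-STRETCHING TYPE-I THRESHOLD FOR NAVIER–STOKES, CONSTANT ONE.** For every `ν > 0`, `T > 0`, every
maximal smooth solution `(u, p)` of the unforced Navier–Stokes system on `ℝ³ × [0, T)` which is Leray–Hopf from `u 0`,
every `M₀ < 1` and every `t₀ ∈ [0, T)`, there are `t ∈ [t₀, T)` and `x ∈ ℝ³` with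
`M₀ ‖ω(t, x)‖² < (T − t)·⟪ω(t, x), ∇u(t, x) ω(t, x)⟫` (`ω = curl u`, `∇u = fderiv`): the stretching rate
`α = ⟪ω, ∇u ω⟫/|ω|²` exceeds `M₀/(T − t)` at a point where `ω ≠ 0` — `limsup_{t↑T} (T − t)·sup α⁺ ≥ 1`. Proof:
translate to `s = (t₀ + T)/2` (`IsMaximalSmoothSolution.translate_zero`), class by
`GeometricFace.hasBoundedSobolevNormsOn_translate`, no continuation by maximality, kernel
`exists_typeI_stretching_gt_of_not_hasSobolevExtensionPast` (`ν ≥ 0`). Necessity only; weak form only.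
[cite: Chae2010, Thm 1.1 (proof, arXiv:0711.1113 p. 3–4)] [cite: Constantin1994, §2] [cite: Tao2011, Cor. 11.1] -/
theorem ns_stretching_typeI_threshold {ν T : ℝ} (hν : 0 < ν) (hT : 0 < T)
    {u : ℝ → EuclideanSpace ℝ (Fin 3) → EuclideanSpace ℝ (Fin 3)} {p : ℝ → EuclideanSpace ℝ (Fin 3) → ℝ}
    (hmax : IsMaximalSmoothSolution ν 0 u p T) (hLH : IsLerayHopfOn T ν 0 (u 0) u)
    {M₀ : ℝ} (hM₀ : M₀ < 1) {t₀ : ℝ} (ht₀ : t₀ ∈ Ico 0 T) :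
    ∃ t ∈ Ico t₀ T, ∃ x : EuclideanSpace ℝ (Fin 3),
      M₀ * ‖curl (u t) x‖ ^ 2 < (T - t) * ⟪curl (u t) x, fderiv ℝ (u t) x (curl (u t) x)⟫ := by
  set s : ℝ := (t₀ + T) / 2 with hsdef
  have hs : s ∈ Ioo 0 T := ⟨by rw [hsdef]; linarith [ht₀.1, ht₀.2], by rw [hsdef]; linarith [ht₀.2]⟩
  have ht₀s : t₀ < s := by rw [hsdef]; linarith [ht₀.2]
  have hTs : 0 < T - s := sub_pos.2 hs.2
  have hmaxs : IsMaximalSmoothSolution ν 0 (fun t => u (t + s)) (fun t => p (t + s)) (T - s) :=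
    hmax.translate_zero hs.1 hs.2
  have hregs : ∀ T'' < T - s, HasBoundedSobolevNormsOn (Icc 0 T'') (fun t => u (t + s)) := fun T'' hT'' =>
    GeometricFace.hasBoundedSobolevNormsOn_translate hν hT hmax hLH hs hT''
  have hblow : ¬ HasSobolevExtensionPast ν (fun t => u (t + s)) (T - s) := fun hext =>
    hmaxs.2 hext.hasSmoothExtensionPast
  obtain ⟨t', ht', x, hx⟩ := exists_typeI_stretching_gt_of_not_hasSobolevExtensionPast hν.le hTs hmaxs.1 hregs
    hblow hM₀ (t₀ := 0) ⟨le_rfl, hTs⟩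
  refine ⟨t' + s, ⟨by linarith [ht'.1], by linarith [ht'.2]⟩, x, ?_⟩
  have e : T - (t' + s) = T - s - t' := by ring
  rw [e]
  exact hx

/-- **L66, filter form**: along every maximal smooth Leray–Hopf solution of the unforced system (`ν > 0`), for every
`M₀ < 1`: `∃ᶠ t in 𝓝[<] T, ∃ x, M₀‖ω(t, x)‖² < (T − t)⟪ω(t, x), ∇u(t, x) ω(t, x)⟫`. [cite: Chae2010, Thm 1.1]
[cite: Constantin1994, §2] -/
theorem ns_stretching_typeI_frequently {ν T : ℝ} (hν : 0 < ν) (hT : 0 < T)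
    {u : ℝ → EuclideanSpace ℝ (Fin 3) → EuclideanSpace ℝ (Fin 3)} {p : ℝ → EuclideanSpace ℝ (Fin 3) → ℝ}
    (hmax : IsMaximalSmoothSolution ν 0 u p T) (hLH : IsLerayHopfOn T ν 0 (u 0) u)
    {M₀ : ℝ} (hM₀ : M₀ < 1) :
    ∃ᶠ t in 𝓝[<] T, ∃ x : EuclideanSpace ℝ (Fin 3),
      M₀ * ‖curl (u t) x‖ ^ 2 < (T - t) * ⟪curl (u t) x, fderiv ℝ (u t) x (curl (u t) x)⟫ := by
  rw [Filter.frequently_iff]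
  intro U hU
  obtain ⟨l, hl, hlU⟩ := mem_nhdsLT_iff_exists_Ioo_subset.1 hU
  set t₀ : ℝ := (max l 0 + T) / 2 with ht₀def
  have hm : max l 0 < T := max_lt hl hT
  have ht₀ : t₀ ∈ Ico 0 T := ⟨by rw [ht₀def]; linarith [le_max_right l 0], by rw [ht₀def]; linarith⟩
  have hlt₀ : l < t₀ := by rw [ht₀def]; linarith [le_max_left l 0]
  obtain ⟨t, ht, x, hx⟩ := ns_stretching_typeI_threshold hν hT hmax hLH hM₀ ht₀
  exact ⟨t, hlU ⟨hlt₀.trans_le ht.1, ht.2⟩, x, hx⟩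

/-- **L66 READ ON THE INTERFACE**: every `W : CascadeWitness` yields `ν > 0`, `T > 0` and a maximal smooth solution
`(u, p)` of the unforced Navier–Stokes system on `ℝ³ × [0, T)`, Leray–Hopf from `u 0` (`x5a_of_cascadeWitness'`), such
that for every `M₀ < 1` and every `t₀ ∈ [0, T)` some `t ∈ [t₀, T)` and `x` have
`M₀‖ω(t, x)‖² < (T − t)⟪ω(t, x), ∇u(t, x) ω(t, x)⟫`. [cite: Chae2010, Thm 1.1] [cite: Constantin1994, §2] -/
theorem ns_stretching_typeI_threshold_of_cascadeWitness (W : CascadeWitness) :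
    ∃ ν : ℝ, 0 < ν ∧ ∃ T : ℝ, 0 < T ∧
      ∃ (u : ℝ → EuclideanSpace ℝ (Fin 3) → EuclideanSpace ℝ (Fin 3)) (p : ℝ → EuclideanSpace ℝ (Fin 3) → ℝ),
        IsMaximalSmoothSolution ν 0 u p T ∧ IsLerayHopfOn T ν 0 (u 0) u ∧
        ∀ M₀ : ℝ, M₀ < 1 → ∀ t₀ ∈ Ico 0 T, ∃ t ∈ Ico t₀ T, ∃ x : EuclideanSpace ℝ (Fin 3),
          M₀ * ‖curl (u t) x‖ ^ 2 < (T - t) * ⟪curl (u t) x, fderiv ℝ (u t) x (curl (u t) x)⟫ := by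
  obtain ⟨ν, hν, T, hT, u, p, hmax, hLH, -⟩ := x5a_of_cascadeWitness' W
  exact ⟨ν, hν, T, hT, u, p, hmax, hLH, fun _ hM₀ _ ht₀ => ns_stretching_typeI_threshold hν hT hmax hLH hM₀ ht₀⟩

/-! ## E2″: the stretching threshold for the Euler controls -/

/-- **E2″ — THE VORTEX-STRETCHING TYPE-I THRESHOLD FOR EULER, CONSTANT ONE.** For a maximal classical Euler solution
`(u, p)` on `ℝ³ × [0, T)` (`T > 0`) in the Beale–Kato–Majda class on every closed sub-slab, for every `M₀ < 1` and every
`t₀ ∈ [0, T)` there are `t ∈ [t₀, T)` and `x` with `M₀‖ω(t, x)‖² < (T − t)⟪ω(t, x), ∇u(t, x) ω(t, x)⟫` —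
`limsup_{t↑T} (T − t)·sup α⁺ ≥ 1`; sharpens E2 (`α ≤ ‖∇u‖`). Class hypothesis carried. Necessity only.
[cite: Chae2010, Thm 1.1] [cite: Constantin1994, §2] [cite: BealeKatoMajda1984, Thm. 1] -/
theorem euler_stretching_typeI_threshold {T : ℝ} (hT : 0 < T)
    {u : ℝ → EuclideanSpace ℝ (Fin 3) → EuclideanSpace ℝ (Fin 3)} {p : ℝ → EuclideanSpace ℝ (Fin 3) → ℝ}
    (hmax : IsMaximalSmoothSolution 0 0 u p T) (hreg : ∀ T'' < T, HasBoundedSobolevNormsOn (Icc 0 T'') u)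
    {M₀ : ℝ} (hM₀ : M₀ < 1) {t₀ : ℝ} (ht₀ : t₀ ∈ Ico 0 T) :
    ∃ t ∈ Ico t₀ T, ∃ x : EuclideanSpace ℝ (Fin 3),
      M₀ * ‖curl (u t) x‖ ^ 2 < (T - t) * ⟪curl (u t) x, fderiv ℝ (u t) x (curl (u t) x)⟫ :=
  exists_typeI_stretching_gt_of_not_hasSobolevExtensionPast le_rfl hT hmax.1 hreg
    (fun hext => hmax.2 hext.hasSmoothExtensionPast) hM₀ ht₀

end Summit.NavierStokesRegularity.FluidComputer.StretchingTypeIFace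

end
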